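import Summits.QuantumFields.BalabanUV.T4Continuum.Support.VariationalColourTaxiTowerLeaves
import Summits.QuantumFields.BalabanUV.T4Continuum.Support.VariationalVectorEndOfLeavesSlice

/-!
# T⁴ programme, spine node NE2 (U1a), lane P2 — «V-COL-TAXI-END»: THE VECTOR END OF ROAD P2 AT BAŁABAN's TAXI DATA, TRANSPORT SIDE INHABITED —
# leaf-10-g3's gauge-slice END `towerLimitRate_effV_of_leaves_slice` at the nested product line transports `nestLv k`, the level bonds `Rlev k` and the
# one-step carriers `lineT (taxiTv (R′ k)) (R′ k)` of a COHERENT tower of UNITARY one-step bond operators; the G-side (V-GF), V-ONE (full fine form) and V-REG DISPLAYED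

NE2 formalisation swarm `b2b-balaban-t4-ne2-formalise-*`, leaf prover 04 GEN 5 (`prover-b2b-balaban-t4-ne2-formalise-leaf-04-g5-0`); register row «P2-sup» of
`t4/formal/NE2/LEAVES.md`; journal CLAIMS.log «V-COL-TAXI-END» (INTENT 2026-08-20 15:38Z).  Compositions BY NAME of leaf-10-g3's
`VariationalVectorEndOfLeaves.towerLimitRate_effV_of_leaves_slice` (p221732) and `VariationalVectorTower.{ubV_transport, qVV_eq_transport, SfV_eq_transport, QvL_comp',
QvL_surjective_of_ub}` (p218948) with this lineage's «V-COL-TAXI» ∕ «V-COL-TAXI-TOWER» parts 1, 5, 6, 10 (`ScV_QvL_taxi_le_curl` p219320, `exists_ubV_taxi_ScV` p221223,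
`Rlev`∕`nestLv`∕`coarseTv_eq_Rlev` p222225, `exists_ubV_nestLv_ScV`∕`qWV_le_nestLv_of_garding` p223104); nothing defined.

THE DATA.  `2 ≤ L`, `1 ≤ d`, `1 < M_μ` (two unit blocks per direction: the block form of the in-block bond hypotheses, part 10 §1); a tower of ONE-STEP bond operators
`R′ k : Tor (fine L (fine (L^k) M)) → Fin d → (ℂ →L[ℂ] ℂ)`, UNITARY, with one-step plaquette defects `b k`, level-`k` plaquette defects `a k` of `Rlev k` (part 10 §1b:
`a (k+1) = b k`, `a 0 ≤ L²·b 0`), COHERENT (`coarseTv (R′ (k+1)) = Rtrv (R′ k)`, [Balaban1985BackgroundPropagators] (3.10) «Ū» SHAPE).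
 * §1 THE ONE-STEP SOCKETS of the END at level `k`, each a named one-step lemma at `(n, M) := (L^k, M)`: `norm_lineT_taxi_le_one` (`hT′1`), `surjective_QvL_taxi`
   (`hsurj₁`: part 5's V-UB at `G := 0` gives the exact constraint for every datum), `hPf_of_hPc_transport` (the converse of p218948's `coerciveV_transport`: a
   level-`n·L` V-P inequality on the composite ∕ transported data IS the fine-member inequality `hPf`), `ScV_QvL_nestLv_le_curl` (`hFEDcurl k`: part 1's curl
   Federbush with `coarseTv (R′ k) = Rlev k` by coherence), `exists_ubV_nestLv_SfV` (`hUBf k` = part 10's `hUBc (k+1)` through `ubV_transport`), `qVV_le_nestLv_of_garding`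
   (`hPf k` = part 10's `hPc (k+1)` transported).
 * §2 **`towerLimitRate_effV_taxiTower_slice`** — THE END AT TAXI DATA: `TowerLimitRate (fun _ ↦ 1) 1 (k ↦ effV (L^k) M (Rlev k) (Gm k) (QmL (L^k) M (nestLv k)) a) C θ`,
   `C = eV Λ⋆ C_P⋆ c_δ + c_σ′·(Λ⋆ + eV Λ⋆ C_P⋆ c_δ) + c_σ·(C_P⋆(Λ⋆+1)) + ePV Λ⋆ C_P⋆ C_R⋆ c_ε c_δ′` (p221732's letter), with the structural ∕ transport-side
   sockets `hTcomp` ∕ `hRtr` (rfl) ∕ `hT′1` ∕ `hsurj₁` ∕ `hUBc` ∕ `hUBf` ∕ `hPc` ∕ `hPf` ∕ `hFEDcurl` DISCHARGED; DISPLAYED: the G-side = leaf V-GF (`Gm k` PSD, `G k = qform (Gm k) ∘ unc`,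
   `G (k+1) = Gtr (G′ k)`, (GF1′)_k `G k ≤ C_G,k·rough_k + C₀,k·Σ‖·‖²`, the GÅRDING half `(L^k)^{−d}((L^k)²·rough_k W) ≤ κ_k·ScV_k W + κ′_k·‖Q W‖²`, the SLICE with `σ k`,
   `σ′ k`), V-ONE for the FULL fine form `SfV (R′ k) (G′ k)` (`ε₁ k`, `δ′ k`, `ρV k`), V-REG (`C_R k`), the four per-level smallness lines of parts 5 ∕ 10, the UNIFORMITY
   of the explicit V-UB constant `Λ_k := lamV d (L^k(d−1)(L^k−1)a_k) C_G,k ((L^k)²C₀,k)∕(1 − κ⁻¹γ_k)² ≤ Λ⋆` and of `κ_k ≤ κ⋆`, `κ′_k ≤ κ′⋆` (`C_P⋆ = max(40κ⋆, 64 + 40κ′⋆)`),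
   and the DECAY of the explicit curl-Federbush parameter `δ_k := d·L^k·(2((d−1)L(L−1)b_k + L²b_k) + 2L·L²b_k) ≤ c_δ·θ^k` — the last three are discharged under
   the scale-invariant plaquette class in the companion file `VariationalColourTaxiTowerEndClass`.
WHAT IS NOT HERE (stated, not hidden): no G-side law is proved (V-GF OPEN); `hONE` for the full fine form is NOT inhabited (part 5's `blockSpin_lineT_taxi_le` bounds the
block-spin value of the CURL fine form `SfV (R′ k) 0`, not of `SfV (R′ k) (G′ k)` — a different socket); V-REG is NOT inhabited here (leaf-03-g5's taxi V-REG p223784 is for the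
ONE-LEVEL carriers `lineT (taxiTv R) R` and the Landau inhabitant; the tower's carriers are `nestLv k`, (E_k)-near them).

HONEST FRAMING (T4-DAG p. 1).  Composition at MODEL level (`E = ℂ`; bond operators DATA; taxi ∕ straight contours OURS; [Balaban1985BackgroundPropagators] (3.10)∕(3.15)∕(3.19),
[Balaban1985AveragingOperations] (125) SHAPES only, no B0, c5); nothing printed is a hypothesis; no `def`, no `def … : Prop`, no `sorry`; axioms standard.  V-GF ∕
V-ONE ∕ V-REG DISPLAYED ⟹ V-END NOT proved; NE2 NOT proved on either road; NE3 OPEN; spine PROVED 0∕9 unchanged; rung (B)+1 finite T⁴ — NOT infinite volume, NOT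
mass gap, NOT Clay.  HONEST DEPENDENCY (cell, verbatim): continuum YM on T⁴ ⇐ BetaPertH ∧ nine spine estimates (0/9 proved); BetaPertH ⇐ (D1) ∧ (D4) ∧ CAP+tail;
G-an2-4 gates asym, D1 and NE2/3/4.
-/

noncomputable section

namespace Summit.QuantumFields.BalabanUV.T4Continuum.VariationalColourTaxiTransport

open scoped Matrix ComplexOrder
open Literature.MathematicalPhysics.QuantumFieldTheory.Balaban1983to89.B5Prop11Plancherel (Tor fine unitVec)
open Literature.MathematicalPhysics.QuantumFieldTheory.Balaban1983to89.B5Composition116 (sites)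
open Literature.Analysis.Complex (qform)
open Summit.QuantumFields.BalabanUV.T4Continuum.VariationalTransfer (blockSpin)
open Summit.QuantumFields.BalabanUV.T4Continuum.VariationalColourFederbush (norm_le_one_of_mem_unitary)
open Summit.QuantumFields.BalabanUV.T4Continuum.VariationalColourTower (Rtrv)
open Summit.QuantumFields.BalabanUV.T4Continuum.VariationalVectorFederbush (lineT norm_lineT_le_one)
open Summit.QuantumFields.BalabanUV.T4Continuum.CovariantAveragingTower (TowerLimitRate)
open Summit.QuantumFields.BalabanUV.T4Continuum.VectorBlockTrialForm (nsqV nsqV_nonneg QvL roughV kappaV compL)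
open Summit.QuantumFields.BalabanUV.T4Continuum.VariationalVectorForm (ScV SfV qWV qVV lamV lamV_nonneg ScV_nonneg)
open Summit.QuantumFields.BalabanUV.T4Continuum.VariationalVectorEffective (unc effV)
open Summit.QuantumFields.BalabanUV.T4Continuum.VariationalVectorTower (Gtr QmL ubV_transport qVV_eq_transport SfV_eq_transport QvL_comp' QvL_surjective_of_ub)
open Summit.QuantumFields.BalabanUV.T4Continuum.VariationalVectorEndOfLeaves (eV ePV nonneg_of_qform towerLimitRate_effV_of_leaves_slice)

variable {d : ℕ}

/-! ## §1 The one-step sockets of the END at taxi data -/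

section OneStep

variable {H : Type*} [NormedAddCommGroup H] [InnerProductSpace ℂ H] [CompleteSpace H]
variable (n L : ℕ) [NeZero n] [NeZero L] (M : Fin d → ℕ) [hM : ∀ μ, NeZero (M μ)]

omit [CompleteSpace H] in
/-- `hT′1`: Bałaban's one-step product line transports at taxi data are contractions, for contractive bond operators. [folklore] -/
theorem norm_lineT_taxi_le_one {R' : Tor (fine L (fine n M)) → Fin d → (H →L[ℂ] H)} (hR' : ∀ x μ, ‖R' x μ‖ ≤ 1)
    (y : Tor (fine n M)) (j : Fin d → Fin L) (t : Fin L) (μ : Fin d) : ‖lineT L (fine n M) (taxiTv L (fine n M) R') R' y j t μ‖ ≤ 1 :=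
  norm_lineT_le_one L (fine n M) hR' (norm_taxiTv_le_one L (fine n M) hR') y j t μ

/-- `hsurj₁`: the one-step average on Bałaban's carriers is ONTO — part 5's V-UB at taxi data with `G := 0` gives the exact constraint for every datum. [folklore] -/
theorem surjective_QvL_taxi [FiniteDimensional ℂ H] {R' : Tor (fine L (fine n M)) → Fin d → (H →L[ℂ] H)} (hU : ∀ x μ, R' x μ ∈ unitary (H →L[ℂ] H))
    {a : ℝ} (ha0 : 0 ≤ a) (ha : ∀ x κ ι, ‖R' x κ * R' (x + unitVec (fine L (fine n M)) κ) ι - R' x ι * R' (x + unitVec (fine L (fine n M)) ι) κ‖ ≤ a)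
    (hd : 1 ≤ d) (hc : (kappaV d L)⁻¹ * (3 * (((d - 1 : ℕ) : ℝ) * L * ((L - 1 : ℕ) : ℝ) * a)) < 1) :
    Function.Surjective (QvL L (fine n M) (lineT L (fine n M) (taxiTv L (fine n M) R') R')) :=
  QvL_surjective_of_ub L (fine n M)
    (exists_ubV_taxi_ScV L (fine n M) hU ha0 ha hd hc le_rfl le_rfl (G := fun _ => 0) (CG := 0) (C₀ := 0) (fun W => by simp))

omit [CompleteSpace H] in
/-- **`hPf` FROM `hPc` ONE LEVEL UP** (the converse of p218948's `coerciveV_transport`): a V-P inequality for the level-`n·L` form on the composite ∕ transported data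
IS the fine-member inequality, through `qVV_eq_transport` ∕ `SfV_eq_transport` ∕ `QvL_comp'`. [folklore] -/
theorem hPf_of_hPc_transport {R' : Tor (fine L (fine n M)) → Fin d → (H →L[ℂ] H)} {G' : (Tor (fine L (fine n M)) → Fin d → H) → ℝ}
    {T : Tor M → (Fin d → Fin n) → Fin n → Fin d → (H →L[ℂ] H)} {T' : Tor (fine n M) → (Fin d → Fin L) → Fin L → Fin d → (H →L[ℂ] H)} {CP : ℝ}
    (hPc : ∀ W, qWV (n * L) M W ≤ CP * (ScV (n * L) M (Rtrv n L M R') (Gtr n L M G') W + nsqV M (QvL (n * L) M (compL n L M T T') W)))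
    (W' : Tor (fine L (fine n M)) → Fin d → H) :
    qVV n L M W' ≤ CP * (SfV n L M R' G' W' + nsqV M (QvL n M T (QvL L (fine n M) T' W'))) := by
  rw [qVV_eq_transport, SfV_eq_transport, QvL_comp']
  exact hPc _

end OneStep

section TowerSockets

variable {H : Type*} [NormedAddCommGroup H] [InnerProductSpace ℂ H] [CompleteSpace H] [FiniteDimensional ℂ H]
variable (L : ℕ) [NeZero L] (M : Fin d → ℕ) [hM : ∀ μ, NeZero (M μ)]
variable {R' : (k : ℕ) → Tor (fine L (fine (L ^ k) M)) → Fin d → (H →L[ℂ] H)} (hU : ∀ k x μ, R' k x μ ∈ unitary (H →L[ℂ] H))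
variable {b : ℕ → ℝ}
  (hb : ∀ k x κ ι, ‖R' k x κ * R' k (x + unitVec (fine L (fine (L ^ k) M)) κ) ι - R' k x ι * R' k (x + unitVec (fine L (fine (L ^ k) M)) ι) κ‖ ≤ b k)
variable (hcoh : ∀ k, coarseTv L (fine (L ^ (k + 1)) M) (R' (k + 1)) = Rtrv (L ^ k) L M (R' k))

include hU hb hcoh

omit [FiniteDimensional ℂ H] in
/-- **`hFEDcurl k` AT TAXI DATA**: part 1's curl Federbush `ScV_QvL_taxi_le_curl` at `(L^k, M)` against the pure-curl fine form, the coarse bonds `coarseTv (R′ k) = Rlev k`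
by coherence; parameter `δ_k = d·(L^k·(2((d−1)L(L−1)b_k + L²b_k) + 2L·(L²b_k)))`. [folklore] -/
theorem ScV_QvL_nestLv_le_curl (k : ℕ) (hb0 : 0 ≤ b k) (W' : Tor (fine L (fine (L ^ k) M)) → Fin d → H) :
    ScV (L ^ k) M (Rlev L M R' k) (fun _ => 0) (QvL L (fine (L ^ k) M) (lineT L (fine (L ^ k) M) (taxiTv L (fine (L ^ k) M) (R' k)) (R' k)) W')
      ≤ (Real.sqrt (SfV (L ^ k) L M (R' k) (fun _ => 0) W')
          + (d : ℝ) * ((((L ^ k : ℕ)) : ℝ) * (2 * (((d - 1 : ℕ) : ℝ) * L * ((L - 1 : ℕ) : ℝ) * b k + L * L * b k) + 2 * L * (L * L * b k)))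
            * Real.sqrt (qVV (L ^ k) L M W')) ^ 2 := by
  have hR' : ∀ x μ, ‖R' k x μ‖ ≤ 1 := fun x μ => norm_le_one_of_mem_unitary (hU k x μ)
  have h := ScV_QvL_taxi_le_curl (L ^ k) L M hR' hb0 (hb k) (G' := fun _ => 0) (fun _ => le_rfl) W'
  rw [coarseTv_eq_Rlev L M R' hcoh k] at h
  simpa only [Nat.cast_pow] using h

/-- **`hUBf k` AT TAXI DATA = `hUBc (k+1)` TRANSPORTED**: part 10's `exists_ubV_nestLv_ScV` at level `k+1` (carriers `nestLv (k+1) = compL (nestLv k) (lineT (taxiTv (R′ k)) (R′ k))`,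
bonds `Rlev (k+1) = Rtrv (R′ k)`, functional `Gtr (G′ k)`) read in one-step coordinates through `ubV_transport`. [folklore] -/
theorem exists_ubV_nestLv_SfV (hd : 1 ≤ d) (k : ℕ) {a : ℝ} (ha0 : 0 ≤ a)
    (ha : ∀ x κ ι, ‖Rlev L M R' (k + 1) x κ * Rlev L M R' (k + 1) (x + unitVec (fine (L ^ (k + 1)) M) κ) ι
      - Rlev L M R' (k + 1) x ι * Rlev L M R' (k + 1) (x + unitVec (fine (L ^ (k + 1)) M) ι) κ‖ ≤ a)
    (hc : (kappaV d (L ^ (k + 1)))⁻¹ * ((∑ q ∈ Finset.range (k + 1), ((((d - 1 : ℕ) : ℝ) + (d : ℝ) * d) * (((L : ℝ) * ((L ^ q - 1 : ℕ) : ℝ) * ((L - 1 : ℕ) : ℝ)) * b q)))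
        + 3 * (((d - 1 : ℕ) : ℝ) * (L ^ (k + 1) : ℕ) * ((L ^ (k + 1) - 1 : ℕ) : ℝ) * a)) < 1)
    {G' : (Tor (fine L (fine (L ^ k) M)) → Fin d → H) → ℝ} {CG C₀ : ℝ} (hCG : 0 ≤ CG) (hC₀ : 0 ≤ C₀)
    (hG : ∀ W, Gtr (L ^ k) L M G' W ≤ CG * roughV (L ^ (k + 1)) M (Rlev L M R' (k + 1)) W + C₀ * nsqV (fine (L ^ (k + 1)) M) W)
    (φ : Tor M → Fin d → H) :
    ∃ W' : Tor (fine L (fine (L ^ k) M)) → Fin d → H,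
      QvL (L ^ k) M (nestLv L M R' k) (QvL L (fine (L ^ k) M) (lineT L (fine (L ^ k) M) (taxiTv L (fine (L ^ k) M) (R' k)) (R' k)) W') = φ ∧
      SfV (L ^ k) L M (R' k) G' W'
        ≤ lamV d ((L ^ (k + 1) : ℕ) * (((d - 1 : ℕ) : ℝ) * ((L ^ (k + 1) - 1 : ℕ) : ℝ) * a)) CG (((L ^ (k + 1) : ℕ) : ℝ) ^ 2 * C₀)
          / (1 - (kappaV d (L ^ (k + 1)))⁻¹ * ((∑ q ∈ Finset.range (k + 1), ((((d - 1 : ℕ) : ℝ) + (d : ℝ) * d) * (((L : ℝ) * ((L ^ q - 1 : ℕ) : ℝ) * ((L - 1 : ℕ) : ℝ)) * b q)))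
              + 3 * (((d - 1 : ℕ) : ℝ) * (L ^ (k + 1) : ℕ) * ((L ^ (k + 1) - 1 : ℕ) : ℝ) * a))) ^ 2 * nsqV M φ :=
  (ubV_transport (L ^ k) L M).mpr (exists_ubV_nestLv_ScV L M hU hb hcoh (k + 1) ha0 ha hd hc hCG hC₀ hG φ)

/-- **`hPf k` AT TAXI DATA = `hPc (k+1)` TRANSPORTED**: part 10's `qWV_le_nestLv_of_garding` at level `k+1` (MODULO the displayed Gårding half at level `k+1`) read in one-step
coordinates through `hPf_of_hPc_transport`. [folklore] -/
theorem qVV_le_nestLv_of_garding (hM2 : ∀ μ, 1 < M μ) (k : ℕ) {a : ℝ}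
    (ha : ∀ x κ ι, ‖Rlev L M R' (k + 1) x κ * Rlev L M R' (k + 1) (x + unitVec (fine (L ^ (k + 1)) M) κ) ι
      - Rlev L M R' (k + 1) x ι * Rlev L M R' (k + 1) (x + unitVec (fine (L ^ (k + 1)) M) ι) κ‖ ≤ a)
    (hsmall : 2 * (d : ℝ) * ((((L ^ (k + 1) : ℕ) : ℝ)) * (((d - 1 : ℕ) : ℝ) * ((L ^ (k + 1) - 1 : ℕ) : ℝ) * a)) ^ 2 ≤ 1 / 2)
    (hγs : 64 * (∑ q ∈ Finset.range (k + 1), ((((d - 1 : ℕ) : ℝ) + (d : ℝ) * d) * (((L : ℝ) * ((L ^ q - 1 : ℕ) : ℝ) * ((L - 1 : ℕ) : ℝ)) * b q))) ^ 2 ≤ 1)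
    {G' : (Tor (fine L (fine (L ^ k) M)) → Fin d → H) → ℝ} (hG0 : ∀ W, 0 ≤ Gtr (L ^ k) L M G' W) {κ κ' : ℝ}
    (hGar : ∀ W, ((((L ^ (k + 1) : ℕ) : ℝ)) ^ d)⁻¹ * ((((L ^ (k + 1) : ℕ) : ℝ)) ^ 2 * roughV (L ^ (k + 1)) M (Rlev L M R' (k + 1)) W)
      ≤ κ * ScV (L ^ (k + 1)) M (Rlev L M R' (k + 1)) (Gtr (L ^ k) L M G') W + κ' * nsqV M (QvL (L ^ (k + 1)) M (nestLv L M R' (k + 1)) W))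
    (W' : Tor (fine L (fine (L ^ k) M)) → Fin d → H) :
    qVV (L ^ k) L M W' ≤ max (40 * κ) (64 + 40 * κ')
      * (SfV (L ^ k) L M (R' k) G' W' + nsqV M (QvL (L ^ k) M (nestLv L M R' k) (QvL L (fine (L ^ k) M) (lineT L (fine (L ^ k) M) (taxiTv L (fine (L ^ k) M) (R' k)) (R' k)) W'))) :=
  hPf_of_hPc_transport (L ^ k) L M (qWV_le_nestLv_of_garding L M hU hb hcoh hM2 (k + 1) ha hsmall hγs hG0 hGar) W'

end TowerSockets

/-! ## §2 THE VECTOR END AT BAŁABAN's TAXI DATA (gauge-slice variant), transport side inhabited -/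

section End

variable (L : ℕ) [NeZero L] (M : Fin d → ℕ) [hM : ∀ μ, NeZero (M μ)]
variable {R' : (k : ℕ) → Tor (fine L (fine (L ^ k) M)) → Fin d → (ℂ →L[ℂ] ℂ)}
variable (Gm : (k : ℕ) → Matrix (Tor (fine (L ^ k) M) × Fin d) (Tor (fine (L ^ k) M) × Fin d) ℂ)
variable (G : (k : ℕ) → (Tor (fine (L ^ k) M) → Fin d → ℂ) → ℝ)
variable (G' : (k : ℕ) → (Tor (fine L (fine (L ^ k) M)) → Fin d → ℂ) → ℝ)

/-- **THE VECTOR END OF ROAD P2 AT BAŁABAN's TAXI DATA — GAUGE-SLICE VARIANT, TRANSPORT SIDE INHABITED.**  DATA: `2 ≤ L` is not needed here (`θ` is general), `1 ≤ d`,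
`1 < M_μ`; a COHERENT tower of UNITARY one-step bond operators `R′ k` with one-step plaquette defects `b k` and level-`k` plaquette defects `a k` of `Rlev k`.
DISCHARGED BY NAME (structural ∕ transport side of leaf-10-g3's `towerLimitRate_effV_of_leaves_slice`): `hTcomp`∕`hRtr` (rfl), `hT′1`, `hsurj₁`, `hUBc k`
(part 10, constant `Λ_k` explicit — its UNIFORM bound `Λ_k ≤ Λ⋆` displayed), `hUBf k` (= `hUBc (k+1)`), `hPc k`∕`hPf k` (parts 10 ∕ §1 modulo the displayed Gårding
halves, `C_P⋆ = max(40κ⋆, 64 + 40κ′⋆)`), `hFEDcurl k` (part 1, parameter `δ_k` explicit — its DECAY `δ_k ≤ c_δ·θ^k` displayed).  DISPLAYED: the G-side (V-GF: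
`Gm k` PSD, matrix form, `G (k+1) = Gtr (G′ k)`, (GF1′)_k, Gårding_k, SLICE_k), V-ONE for the full fine form, V-REG, four per-level smallness lines.  THEN
`TowerLimitRate (fun _ ↦ 1) 1 (k ↦ effV (L^k) M (Rlev k) (Gm k) (QmL (L^k) M (nestLv k)) a) (eV Λ⋆ C_P⋆ c_δ + c_σ′·(Λ⋆ + eV Λ⋆ C_P⋆ c_δ) + c_σ·(C_P⋆(Λ⋆+1)) + ePV Λ⋆ C_P⋆ C_R⋆ c_ε c_δ′) θ`
(the effective-operator parameter `a` of p221732 is spelled `aa` here, `a k` being the level plaquette defects). [folklore] -/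
theorem towerLimitRate_effV_taxiTower_slice (hd : 1 ≤ d) (hM2 : ∀ μ, 1 < M μ)
    -- the one-step bond data: unitary, plaquette defects (one-step `b`, level `a`), coherent
    (hU : ∀ k x μ, R' k x μ ∈ unitary (ℂ →L[ℂ] ℂ)) {b a : ℕ → ℝ}
    (hb : ∀ k x κ ι, ‖R' k x κ * R' k (x + unitVec (fine L (fine (L ^ k) M)) κ) ι - R' k x ι * R' k (x + unitVec (fine L (fine (L ^ k) M)) ι) κ‖ ≤ b k)
    (ha0 : ∀ k, 0 ≤ a k)
    (ha : ∀ k x κ ι, ‖Rlev L M R' k x κ * Rlev L M R' k (x + unitVec (fine (L ^ k) M) κ) ι - Rlev L M R' k x ι * Rlev L M R' k (x + unitVec (fine (L ^ k) M) ι) κ‖ ≤ a k)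
    (hcoh : ∀ k, coarseTv L (fine (L ^ (k + 1)) M) (R' (k + 1)) = Rtrv (L ^ k) L M (R' k))
    -- the G-side (leaf V-GF, DISPLAYED): matrix form, transport identity, (GF1′), the Gårding half, the gauge SLICE
    (hGm : ∀ k, (Gm k).PosSemidef) (hG : ∀ k W, G k W = qform (Gm k) (unc W)) (hGtr : ∀ k, G (k + 1) = Gtr (L ^ k) L M (G' k))
    {CG C₀ κg κg' : ℕ → ℝ} {κs κs' : ℝ} (hCG : ∀ k, 0 ≤ CG k) (hC₀ : ∀ k, 0 ≤ C₀ k) (hκg' : ∀ k, 0 ≤ κg' k) (hκs : ∀ k, κg k ≤ κs) (hκs' : ∀ k, κg' k ≤ κs')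
    (hGF : ∀ k W, G k W ≤ CG k * roughV (L ^ k) M (Rlev L M R' k) W + C₀ k * nsqV (fine (L ^ k) M) W)
    (hGar : ∀ k W, ((((L ^ k : ℕ) : ℝ)) ^ d)⁻¹ * ((((L ^ k : ℕ) : ℝ)) ^ 2 * roughV (L ^ k) M (Rlev L M R' k) W)
      ≤ κg k * ScV (L ^ k) M (Rlev L M R' k) (G k) W + κg' k * nsqV M (QvL (L ^ k) M (nestLv L M R' k) W))
    (σ σ' : ℕ → ℝ) {cσ cσ' : ℝ} (hσ : ∀ k, 0 ≤ σ k) (hσ' : ∀ k, 0 ≤ σ' k)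
    (hslice : ∀ k W, ∃ Ws, QvL (L ^ k) M (nestLv L M R' k) Ws = QvL (L ^ k) M (nestLv L M R' k) W ∧
      ScV (L ^ k) M (Rlev L M R' k) (G k) Ws ≤ ScV (L ^ k) M (Rlev L M R' k) (fun _ => 0) W + σ' k * ScV (L ^ k) M (Rlev L M R' k) (fun _ => 0) W
        + σ k * qWV (L ^ k) M W)
    -- the per-level smallness lines of parts 5 ∕ 10 (discharged under the plaquette class in the companion file)
    (hcUB : ∀ k, (kappaV d (L ^ k))⁻¹ * ((∑ q ∈ Finset.range k, ((((d - 1 : ℕ) : ℝ) + (d : ℝ) * d) * (((L : ℝ) * ((L ^ q - 1 : ℕ) : ℝ) * ((L - 1 : ℕ) : ℝ)) * b q)))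
        + 3 * (((d - 1 : ℕ) : ℝ) * (L ^ k : ℕ) * ((L ^ k - 1 : ℕ) : ℝ) * a k)) < 1)
    (hsmallP : ∀ k, 2 * (d : ℝ) * ((((L ^ k : ℕ) : ℝ)) * (((d - 1 : ℕ) : ℝ) * ((L ^ k - 1 : ℕ) : ℝ) * a k)) ^ 2 ≤ 1 / 2)
    (hγs : ∀ k, 64 * (∑ q ∈ Finset.range k, ((((d - 1 : ℕ) : ℝ) + (d : ℝ) * d) * (((L : ℝ) * ((L ^ q - 1 : ℕ) : ℝ) * ((L - 1 : ℕ) : ℝ)) * b q))) ^ 2 ≤ 1)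
    (hc1 : ∀ k, (kappaV d L)⁻¹ * (3 * (((d - 1 : ℕ) : ℝ) * L * ((L - 1 : ℕ) : ℝ) * b k)) < 1)
    -- rate, uniformity of the explicit V-UB constant, decay of the explicit curl-Federbush parameter and of the slice costs
    {aa : ℝ} (haa : 0 < aa) {θ Λs cδ : ℝ} (hθ : 0 ≤ θ) (hθ1 : θ < 1)
    (hΛs : ∀ k, lamV d ((L ^ k : ℕ) * (((d - 1 : ℕ) : ℝ) * ((L ^ k - 1 : ℕ) : ℝ) * a k)) (CG k) (((L ^ k : ℕ) : ℝ) ^ 2 * C₀ k)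
      / (1 - (kappaV d (L ^ k))⁻¹ * ((∑ q ∈ Finset.range k, ((((d - 1 : ℕ) : ℝ) + (d : ℝ) * d) * (((L : ℝ) * ((L ^ q - 1 : ℕ) : ℝ) * ((L - 1 : ℕ) : ℝ)) * b q)))
          + 3 * (((d - 1 : ℕ) : ℝ) * (L ^ k : ℕ) * ((L ^ k - 1 : ℕ) : ℝ) * a k))) ^ 2 ≤ Λs)
    (hδθ : ∀ k, (d : ℝ) * ((((L ^ k : ℕ)) : ℝ) * (2 * (((d - 1 : ℕ) : ℝ) * L * ((L - 1 : ℕ) : ℝ) * b k + L * L * b k) + 2 * L * (L * L * b k))) ≤ cδ * θ ^ k)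
    (hσθ : ∀ k, σ k ≤ cσ * θ ^ k) (hσ'θ : ∀ k, σ' k ≤ cσ' * θ ^ k)
    -- leaf V-ONE for the FULL fine form and leaf V-REG (DISPLAYED)
    (CR ε₁ δ' : ℕ → ℝ) {CRs cε cδ' : ℝ} (hCR : ∀ k, 0 ≤ CR k) (hCRs : ∀ k, CR k ≤ CRs) (hε₁ : ∀ k, 0 ≤ ε₁ k) (hδ' : ∀ k, 0 ≤ δ' k)
    (hεθ : ∀ k, ε₁ k ≤ cε * θ ^ k) (hδ'θ : ∀ k, δ' k ≤ cδ' * θ ^ k)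
    {ρV : (k : ℕ) → (Tor (fine (L ^ k) M) → Fin d → ℂ) → ℝ} (hρ0 : ∀ k W, 0 ≤ ρV k W)
    (hONE : ∀ k W, blockSpin (QvL L (fine (L ^ k) M) (lineT L (fine (L ^ k) M) (taxiTv L (fine (L ^ k) M) (R' k)) (R' k))) (SfV (L ^ k) L M (R' k) (G' k)) W
      ≤ (Real.sqrt (ScV (L ^ k) M (Rlev L M R' k) (G k) W + ε₁ k * ρV k W) + δ' k * Real.sqrt (qWV (L ^ k) M W)) ^ 2)
    (hREG : ∀ k (φ : Tor M → Fin d → ℂ) W, QvL (L ^ k) M (nestLv L M R' k) W = φ →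
      (∀ W₂, QvL (L ^ k) M (nestLv L M R' k) W₂ = φ → ScV (L ^ k) M (Rlev L M R' k) (G k) W ≤ ScV (L ^ k) M (Rlev L M R' k) (G k) W₂) →
      ρV k W ≤ CR k * (ScV (L ^ k) M (Rlev L M R' k) (G k) W + nsqV M φ)) :
    TowerLimitRate (ι := fun _ => Tor M × Fin d) (fun _ => (1 : Matrix (Tor M × Fin d) (Tor M × Fin d) ℂ)) 1
      (fun k => effV (L ^ k) M (Rlev L M R' k) (Gm k) (QmL (L ^ k) M (nestLv L M R' k)) aa)
      (eV Λs (max (40 * κs) (64 + 40 * κs')) cδ + cσ' * (Λs + eV Λs (max (40 * κs) (64 + 40 * κs')) cδ)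
        + cσ * (max (40 * κs) (64 + 40 * κs') * (Λs + 1)) + ePV Λs (max (40 * κs) (64 + 40 * κs')) CRs cε cδ') θ := by
  -- (GF0) at every level from the matrix form; at level `k+1` read through `Gtr`
  have hG0 : ∀ k W, 0 ≤ G k W := fun k => nonneg_of_qform (L ^ k) M (hGm k) (hG k)
  have hG0tr : ∀ k W, 0 ≤ Gtr (L ^ k) L M (G' k) W := fun k W => by rw [← hGtr k]; exact hG0 (k + 1) W
  have hGFtr : ∀ k W, Gtr (L ^ k) L M (G' k) W ≤ CG (k + 1) * roughV (L ^ (k + 1)) M (Rlev L M R' (k + 1)) W + C₀ (k + 1) * nsqV (fine (L ^ (k + 1)) M) W :=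
    fun k W => by rw [← hGtr k]; exact hGF (k + 1) W
  have hGartr : ∀ k W, ((((L ^ (k + 1) : ℕ) : ℝ)) ^ d)⁻¹ * ((((L ^ (k + 1) : ℕ) : ℝ)) ^ 2 * roughV (L ^ (k + 1)) M (Rlev L M R' (k + 1)) W)
      ≤ κg (k + 1) * ScV (L ^ (k + 1)) M (Rlev L M R' (k + 1)) (Gtr (L ^ k) L M (G' k)) W
        + κg' (k + 1) * nsqV M (QvL (L ^ (k + 1)) M (nestLv L M R' (k + 1)) W) := fun k W => by rw [← hGtr k]; exact hGar (k + 1) W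
  have hR' : ∀ k x μ, ‖R' k x μ‖ ≤ 1 := fun k x μ => norm_le_one_of_mem_unitary (hU k x μ)
  have hb0 : ∀ k, 0 ≤ b k := fun k => (norm_nonneg _).trans (hb k 0 ⟨0, hd⟩ ⟨0, hd⟩)
  -- the explicit V-UB constants `Λ_k` and their nonnegativity
  set Λ : ℕ → ℝ := fun k => lamV d ((L ^ k : ℕ) * (((d - 1 : ℕ) : ℝ) * ((L ^ k - 1 : ℕ) : ℝ) * a k)) (CG k) (((L ^ k : ℕ) : ℝ) ^ 2 * C₀ k)
      / (1 - (kappaV d (L ^ k))⁻¹ * ((∑ q ∈ Finset.range k, ((((d - 1 : ℕ) : ℝ) + (d : ℝ) * d) * (((L : ℝ) * ((L ^ q - 1 : ℕ) : ℝ) * ((L - 1 : ℕ) : ℝ)) * b q)))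
          + 3 * (((d - 1 : ℕ) : ℝ) * (L ^ k : ℕ) * ((L ^ k - 1 : ℕ) : ℝ) * a k))) ^ 2 with hΛdef
  have hΛ0 : ∀ k, 0 ≤ Λ k := fun k => div_nonneg (lamV_nonneg (hCG k) (by have := hC₀ k; positivity)) (sq_nonneg _)
  have hΛs0 : 0 ≤ Λs := (hΛ0 0).trans (hΛs 0)
  -- the uniform V-P constant
  set CPs : ℝ := max (40 * κs) (64 + 40 * κs') with hCPs
  have hCPk : ∀ k, max (40 * κg k) (64 + 40 * κg' k) ≤ CPs := fun k => max_le_max (by linarith [hκs k]) (by linarith [hκs' k])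
  have hCPk0 : ∀ k, 0 ≤ max (40 * κg k) (64 + 40 * κg' k) := fun k => le_max_of_le_right (by linarith [hκg' k])
  have hCPs0 : 0 ≤ CPs := (hCPk0 0).trans (hCPk 0)
  -- leaf V-UB at both levels (parts 10 ∕ §1), weakened to the uniform constant
  have hUBc : ∀ k (φ : Tor M → Fin d → ℂ), ∃ W, QvL (L ^ k) M (nestLv L M R' k) W = φ ∧ ScV (L ^ k) M (Rlev L M R' k) (G k) W ≤ Λs * nsqV M φ :=
    fun k φ => by
    obtain ⟨W, hW, hS⟩ := exists_ubV_nestLv_ScV L M hU hb hcoh k (ha0 k) (ha k) hd (hcUB k) (hCG k) (hC₀ k) (hGF k) φ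
    exact ⟨W, hW, hS.trans (mul_le_mul_of_nonneg_right (hΛs k) (nsqV_nonneg M φ))⟩
  have hUBf : ∀ k (φ : Tor M → Fin d → ℂ), ∃ W', QvL (L ^ k) M (nestLv L M R' k)
      (QvL L (fine (L ^ k) M) (lineT L (fine (L ^ k) M) (taxiTv L (fine (L ^ k) M) (R' k)) (R' k)) W') = φ ∧
      SfV (L ^ k) L M (R' k) (G' k) W' ≤ Λs * nsqV M φ := fun k φ => by
    obtain ⟨W', hW', hS⟩ := exists_ubV_nestLv_SfV L M hU hb hcoh hd k (ha0 (k + 1)) (ha (k + 1)) (hcUB (k + 1)) (hCG (k + 1)) (hC₀ (k + 1)) (hGFtr k) φ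
    exact ⟨W', hW', hS.trans (mul_le_mul_of_nonneg_right (hΛs (k + 1)) (nsqV_nonneg M φ))⟩
  -- leaf V-P at both levels modulo the Gårding halves (parts 10 ∕ §1), weakened to the uniform constant
  have hPc : ∀ k W, qWV (L ^ k) M W ≤ CPs * (ScV (L ^ k) M (Rlev L M R' k) (G k) W + nsqV M (QvL (L ^ k) M (nestLv L M R' k) W)) := fun k W => by
    have h := qWV_le_nestLv_of_garding L M hU hb hcoh hM2 k (ha k) (hsmallP k) (hγs k) (hG0 k) (hGar k) W
    exact h.trans (mul_le_mul_of_nonneg_right (hCPk k) (add_nonneg (ScV_nonneg (L ^ k) M _ (hG0 k) W) (nsqV_nonneg M _)))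
  have hPf : ∀ k W', qVV (L ^ k) L M W' ≤ CPs * (SfV (L ^ k) L M (R' k) (G' k) W'
      + nsqV M (QvL (L ^ k) M (nestLv L M R' k) (QvL L (fine (L ^ k) M) (lineT L (fine (L ^ k) M) (taxiTv L (fine (L ^ k) M) (R' k)) (R' k)) W'))) :=
    fun k W' => by
    have h := qVV_le_nestLv_of_garding L M hU hb hcoh hM2 k (ha (k + 1)) (hsmallP (k + 1)) (hγs (k + 1)) (hG0tr k) (hGartr k) W'
    refine h.trans (mul_le_mul_of_nonneg_right (hCPk (k + 1)) (add_nonneg ?_ (nsqV_nonneg M _)))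
    rw [SfV_eq_transport]
    exact ScV_nonneg (L ^ k * L) M _ (hG0tr k) _
  -- the END of leaf-10-g3, fed
  exact towerLimitRate_effV_of_leaves_slice L M (Rlev L M R') R' Gm G G' (nestLv L M R')
    (fun k => lineT L (fine (L ^ k) M) (taxiTv L (fine (L ^ k) M) (R' k)) (R' k)) hGm hG (fun k => rfl) (fun k => rfl) hGtr
    (fun k y j t μ => norm_lineT_taxi_le_one (L ^ k) L M (hR' k) y j t μ)
    (fun k => surjective_QvL_taxi (L ^ k) L M (hU k) (hb0 k) (hb k) hd (hc1 k)) haa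
    (fun _ => Λs) (fun _ => CPs) CR
    (fun k => (d : ℝ) * ((((L ^ k : ℕ)) : ℝ) * (2 * (((d - 1 : ℕ) : ℝ) * L * ((L - 1 : ℕ) : ℝ) * b k + L * L * b k) + 2 * L * (L * L * b k))))
    ε₁ δ' σ σ' (fun _ => hΛs0) (fun _ => le_rfl) (fun _ => hCPs0) (fun _ => le_rfl) hCR hCRs
    (fun k => by have := hb0 k; positivity) hε₁ hδ' hσ hσ' hθ hθ1 hδθ hεθ hδ'θ hσθ hσ'θ hρ0 hUBc hUBf hPc hPf
    (fun k W' => ScV_QvL_nestLv_le_curl L M hU hb hcoh k (hb0 k) W') hslice hONE hREG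

end End

end Summit.QuantumFields.BalabanUV.T4Continuum.VariationalColourTaxiTransport

end
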